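import Summits.QuantumAdvantage.QuantumAdvantage.Theorems.CubicForrelationNearExactIsExactTwelveLevelFive930GranularB
import Summits.QuantumAdvantage.QuantumAdvantage.Theorems.CubicForrelationNearExactIsExactTwelveLevelFiveOffFlat930Le
import Summits.QuantumAdvantage.QuantumAdvantage.Theorems.CubicForrelationNearExactIsExactTwelveLevelFive930Structure
import Summits.QuantumAdvantage.QuantumAdvantage.Theorems.CubicForrelationNearExactIsExactTwelveQuadSpectrumB

/-!
# Crux `CubicForrelation.NearExactIsExact` (stmt-QuantumAdvantage-14043) — n = 12, a level-5 side AT `Φ ≥ 930/1024`: the residual structure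
  (`e = σ + 8r` on the odd hyperplane, `r` tiny; the hyperplane character sums `Ŝ = 64m` with `m ∈ {0, ±16, ±32}`; the partner's spectrum
  `W_f = 64(−1)^g − 32m − 4r̂`)

Certificate seat `b2b-cforr-cert` (gen 20).  HONEST FRAMING: a kernel-checked structure lemma (standard axioms) about cubic Boolean pairs on 12 bits,
the first half of the proof that NO level-5 side exists at the value `Φ = 930/1024` (HOME/b2b-cforr-cert-g20/PROOF-N12-930-L5.md; the kill is
…TwelveLevelFive930Dead).  Finite-slice bookkeeping, NOT summit progress, NO new value of `θ₁₂` claimed here.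

Setting: cubic `f, g`, `W_g = 32u'`, `u'` odd somewhere, `Φ(f,g) ≥ 930/1024`; `e = u' − 2(−1)^f`, `Σ e² = 32768(1 − Φ) ≤ 3008`.  VERBATIM from
gen 18's `tw19_levelFive_gt930_structure` (budget `960` instead of `959`): the odd set `P = {(−1)^{γ·x} = t}` is a hyperplane, `e = 0` off `P`
(`tw20_off_flat_930le`), the quadratic digit `D` (`tw59_quadratic_digit`), `σ = (−1)^D`, and round 1 of the parity cascade: `8 ∣ e − σ` on `P`
(an odd quotient costs `8`, and `8·2⁷ = 1024 > 960`).  NEW: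
* `r := (e − σ)/8` on `P` (`0` off `P`): `e² − 1 = 16r(4r + σ) ≥ 48r²`, so `Σ r² ≤ 20`, `|r̂(y)| ≤ 20`, `Σ_y r̂(y)² = 4096·Σr² ≤ 81920`
  (`r̂(y) = Σ_x r(x)(−1)^{x·y}`).
* STRADDLING 5-FLATS: Ax's `8 ∣ Σ_F e` for the 5-flat `F = A ∪ (A ⊕ v)`, `A ⊂ P` a parametrised 4-flat, `(−1)^{γ·v} = −1`, gives `8 ∣ Σ_A σ`;
  hence (…TwelveLevelFive930Granular / …GranularB) `Ŝ(y) = Σ_{x∈P} σ(x)(−1)^{x·y} = 64m(y)` with `m(y) ∈ {0, ±16, ±32}`; `m ≢ 0`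
  (Parseval).
* WALSH INVERSION: `Σ_x W_g(x)(−1)^{x·y} = 4096(−1)^{g(y)}` and `u' = 2(−1)^f + 1_P(σ + 8r)` give `W_f(y) = 64(−1)^{g(y)} − 32m(y) − 4r̂(y)`.
* `Φ < 1` (some `e` is odd).

References: J. Ax (1964) / R. J. McEliece (1972); MacWilliams–Sloane (1977) Ch. 13 §3, Ch. 15 §2; C. Carlet (2021) §4.1, §5.2.  Everything below
is proved from Mathlib and the tree; axioms are the standard three.
-/

set_option linter.dupNamespace false -- D-0017: single-problem summit ⇒ `QuantumAdvantage.QuantumAdvantage` by design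

noncomputable section

namespace Summit.QuantumAdvantage.QuantumAdvantage.Theorems.CubicForrelation.NearExactIsExact

open Finset
open Literature.Computability.QuantumComplexity
open Literature.Computability.QuantumComplexity.BuzetChailloux (bxor zeroVec bxor_bxor_cancel_left bxor_zeroVec zeroVec_bxor bxor_comm
  bxor_self twist_zeroVec_right twist_bxor_right)
open Literature.Computability.QuantumComplexity.DerivativeWalsh (W sum_W_sq twist_bxor_left card_mul_card_perp)
open Literature.Computability.QuantumComplexity.Simon (twist_eq_one_or twist_mul_self)

/-! ### The residual structure of a level-5 side at `Φ ≥ 930/1024` -/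

/-- **Structure of a level-5 side at `Φ ≥ 930/1024` on 12 bits** (see the module docstring).  Finite-slice statement, NOT summit progress.
[this work] -/
theorem tw20_levelFive_ge930_residual (f g : (Fin (6 + 6) → Bool) → Bool) (hf : IsDegLeFun 3 f) (hg : IsDegLeFun 3 g)
    (u' : (Fin (6 + 6) → Bool) → ℤ) (hu' : ∀ x, W (fun y => signOf (g y)) x = (2 : ℝ) ^ 5 * (u' x : ℝ))
    (hodd : ∃ x, Odd (u' x)) (hΦ : (930 / 1024 : ℝ) ≤ forrelation f g) :
    ∃ (γ : Fin (6 + 6) → Bool) (tg : ℝ) (D : (Fin (6 + 6) → Bool) → Bool) (r m : (Fin (6 + 6) → Bool) → ℤ),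
      (tg = 1 ∨ tg = -1) ∧ γ ≠ zeroVec ∧ (∀ x, (Odd (u' x) ↔ twist γ x = tg)) ∧ IsDegLeFun 2 D ∧
      (∀ x, ¬ Odd (u' x) → r x = 0) ∧
      (∀ x, u' x = 2 * sZ (f x) + (if Odd (u' x) then sZ (D x) + 8 * r x else 0)) ∧
      (∑ x, r x ^ 2 ≤ 20) ∧
      (∀ y, |∑ x, (r x : ℝ) * twist x y| ≤ 20) ∧
      (∑ y, (∑ x, (r x : ℝ) * twist x y) ^ 2 ≤ 81920) ∧
      (∀ y, m y = 0 ∨ |m y| = 16 ∨ |m y| = 32) ∧ (∃ y, m y ≠ 0) ∧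
      (∀ y, ∑ x ∈ univ.filter (fun x : Fin (6 + 6) → Bool => twist γ x = tg), (sZ (D x) : ℝ) * twist x y = 64 * (m y : ℝ)) ∧
      (∀ y, W (fun x => signOf (f x)) y = 64 * signOf (g y) - 32 * (m y : ℝ) - 4 * ∑ x, (r x : ℝ) * twist x y) ∧
      forrelation f g < 1 := by
  classical
  -- `u = 2u'` at the Ax level `4`; residual `e = u' − 2s`, budget `B = Σ e² = 2¹⁵(1 − Φ) ≤ 3008`
  set u : (Fin (6 + 6) → Bool) → ℤ := fun x => 2 * u' x with hudef
  have hu : ∀ x, W (fun y => signOf (g y)) x = (2 : ℝ) ^ 4 * (u x : ℝ) := by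
    intro x; rw [hu' x]; simp only [u]; push_cast; ring
  set e : (Fin (6 + 6) → Bool) → ℤ := fun x => u' x - 2 * sZ (f x) with hedef
  have hbud := tw12_budget f g u hu
  have h4e : ∀ x, (u x - 4 * sZ (f x)) ^ 2 = 4 * e x ^ 2 := fun x => by simp only [u, e]; ring
  have hBR : ((∑ x, e x ^ 2 : ℤ) : ℝ) = 32768 * (1 - forrelation f g) := by
    have h' : ((∑ x, (u x - 4 * sZ (f x)) ^ 2 : ℤ) : ℝ) = 4 * ((∑ x, e x ^ 2 : ℤ) : ℝ) := by
      rw [sum_congr rfl fun x _ => h4e x, ← mul_sum]; push_cast; ring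
    rw [h'] at hbud
    linarith
  have hB_le : (∑ x, e x ^ 2 : ℤ) ≤ 3008 := by
    have h' : ((∑ x, e x ^ 2 : ℤ) : ℝ) ≤ 3008 := by rw [hBR]; linarith
    exact_mod_cast h'
  -- off the hyperplane the pair is exact
  have hoff := tw20_off_flat_930le f g hf hg u' hu' hodd hΦ
  have he0 : ∀ y, ¬ Odd (u' y) → e y = 0 := fun y hy => by
    show u' y - 2 * sZ (f y) = 0
    rw [hoff y hy]; ring
  -- the odd hyperplane `P = x₀ ⊕ V` and the quadratic digit `D`
  obtain ⟨γ, tg, htg, hγ0, hPg⟩ := tw20_hyperplane_930le f g hg u' hu' hodd hΦ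
  obtain ⟨i, hγi⟩ := tw59_exists_coord γ hγ0
  obtain ⟨D, hD, hDig⟩ := tw59_quadratic_digit f g hg u' hu' γ tg hPg i hγi hoff
  set P := univ.filter (fun x : Fin (6 + 6) → Bool => Odd (u' x)) with hPdef
  have hmemP : ∀ x, x ∈ P ↔ Odd (u' x) := fun x => by simp [hPdef]
  have hmemP' : ∀ x, x ∈ P ↔ twist γ x = tg := fun x => by rw [hmemP, hPg]
  set V := univ.filter (fun a : Fin (6 + 6) → Bool => twist γ a = 1) with hVdef
  have hVmem : ∀ a, a ∈ V ↔ twist γ a = 1 := fun a => by rw [hVdef, mem_filter]; simp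
  have hV0 : zeroVec ∈ V := (hVmem _).2 (twist_zeroVec_right γ)
  have hVadd : ∀ x ∈ V, ∀ y ∈ V, bxor x y ∈ V := by
    intro x hx y hy; rw [hVmem] at hx hy ⊢; rw [twist_bxor_right, hx, hy, mul_one]
  have hVcard : #V = 2 ^ 11 := by rw [hVdef, tw59_card_half γ hγ0 1 (Or.inl rfl)]; norm_num
  obtain ⟨x₀, hx₀⟩ := id hodd
  have hx₀P : x₀ ∈ P := (hmemP x₀).2 hx₀
  have hPimg : P = V.image (bxor x₀) := tw59_eq_image P V γ tg hmemP' hVmem x₀ hx₀P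
  have hPV : ∀ x, x ∈ P → ∀ a ∈ V, bxor x a ∈ P := fun x hx a ha => fl1_coset_vadd hVadd hPimg hx ha
  have hcardP : #P = 2048 := by
    have e1 : P = univ.filter (fun x : Fin (6 + 6) → Bool => twist γ x = tg) := by
      ext x; rw [hmemP', mem_filter]; simp
    rw [e1]; exact tw59_card_half γ hγ0 tg htg
  -- cost accounting on `P`
  have heodd : ∀ x, x ∈ P → Odd (e x) := by
    intro x hx
    exact Int.odd_sub.2 (iff_of_true ((hmemP x).1 hx) ⟨sZ (f x), two_mul _⟩)
  have hsq1 : ∀ x, x ∈ P → 1 ≤ e x ^ 2 := by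
    intro x hx
    have h0 := Int.odd_iff.1 (heodd x hx)
    have : e x ≤ -1 ∨ 1 ≤ e x := by omega
    have := tp_sq_ge (k := 1) (by norm_num) this
    linarith
  have hsplit : (∑ x, e x ^ 2 : ℤ) = ∑ x ∈ P, e x ^ 2 :=
    (sum_subset (subset_univ P) fun x _ hx => by
      rw [he0 x (fun h => hx ((hmemP x).2 h))]; ring).symm
  have hPsum : ∑ x ∈ P, e x ^ 2 ≤ 3008 := by rw [← hsplit]; exact hB_le
  have hcost : ∀ (T : Finset (Fin (6 + 6) → Bool)) (c : ℤ), T ⊆ P → (∀ x ∈ T, c ≤ e x ^ 2 - 1) → c * #T ≤ 960 := by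
    intro T c hT hc
    have h1 : c * #T ≤ ∑ x ∈ T, (e x ^ 2 - 1) := by
      calc c * #T = ∑ x ∈ T, c := by rw [sum_const, nsmul_eq_mul, mul_comm]
        _ ≤ ∑ x ∈ T, (e x ^ 2 - 1) := sum_le_sum hc
    have h2 : ∑ x ∈ T, (e x ^ 2 - 1) ≤ ∑ x ∈ P, (e x ^ 2 - 1) :=
      sum_le_sum_of_subset_of_nonneg hT fun x hx _ => by linarith [hsq1 x hx]
    have h3 : ∑ x ∈ P, (e x ^ 2 - 1) = ∑ x ∈ P, e x ^ 2 - 2048 := by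
      rw [sum_sub_distrib, sum_const, hcardP]; norm_num
    linarith
  -- flat sums of `e = u' − 2s`: `8 ∣` on 5-flats, `16 ∣` on 7-flats, `32 ∣` on 10-flats
  have hflat : ∀ (k c : ℕ) (M : ℤ), (2 : ℤ) ^ (c + 1) = 2 * M → 4 + (c + 1) ≤ k + (6 + 6 - k + 2) / 3 → M ∣ 2 * 2 ^ ((k + 2) / 3) →
      ∀ (b : Fin (6 + 6) → Bool) (a : Fin k → Fin (6 + 6) → Bool),
      M ∣ ∑ ε : Fin k → Bool, e (fun j => b j ^^ decide (Odd #(univ.filter fun i => ε i && a i j))) := by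
    intro k c M hM hk hM' b a
    have h1 := fs_flat_sum_dvd (e := c + 1) g u hg hu b a hk
    obtain ⟨zf, hzf⟩ := sl_sum_sZ_flat f hf b a
    have hzf' : ∑ ε : Fin k → Bool, 2 * sZ (f (fun j => b j ^^ decide (Odd #(univ.filter fun i => ε i && a i j)))) =
        2 * 2 ^ ((k + 2) / 3) * zf := by
      rw [← mul_sum, hzf, ← mul_assoc]
    have h1' : 2 * M ∣ 2 * ∑ ε : Fin k → Bool, u' (fun j => b j ^^ decide (Odd #(univ.filter fun i => ε i && a i j))) := by
      rw [← hM, mul_sum]; exact h1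
    have h1'' : M ∣ ∑ ε : Fin k → Bool, u' (fun j => b j ^^ decide (Odd #(univ.filter fun i => ε i && a i j))) :=
      (mul_dvd_mul_iff_left two_ne_zero).1 h1'
    have h3 : ∑ ε : Fin k → Bool, e (fun j => b j ^^ decide (Odd #(univ.filter fun i => ε i && a i j))) =
        ∑ ε : Fin k → Bool, u' (fun j => b j ^^ decide (Odd #(univ.filter fun i => ε i && a i j))) -
        ∑ ε : Fin k → Bool, 2 * sZ (f (fun j => b j ^^ decide (Odd #(univ.filter fun i => ε i && a i j)))) := by
      rw [← sum_sub_distrib]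
    rw [h3, hzf']
    exact dvd_sub h1'' (dvd_mul_of_dvd_left hM' _)
  have hflat5 := hflat 5 3 8 (by norm_num) (by norm_num) (by norm_num)
  -- flat sums of the quadratic sign `σ = (−1)^D`: `8 ∣`, `16 ∣`, `32 ∣`
  have hquad5 : ∀ (b : Fin (6 + 6) → Bool) (a : Fin 5 → Fin (6 + 6) → Bool),
      (8 : ℤ) ∣ ∑ ε : Fin 5 → Bool, sZ (D (fun j => b j ^^ decide (Odd #(univ.filter fun i => ε i && a i j)))) := by
    intro b a; have h := tw15_quad_flat_sum D hD b a; rw [show (2 : ℤ) ^ ((5 + 1) / 2) = 8 by norm_num] at h; exact h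
  -- combined: the flat sums of `e − σ`
  have hcomb : ∀ (k : ℕ) (M : ℤ),
      (∀ (b : Fin (6 + 6) → Bool) (a : Fin k → Fin (6 + 6) → Bool),
        M ∣ ∑ ε : Fin k → Bool, e (fun j => b j ^^ decide (Odd #(univ.filter fun i => ε i && a i j)))) →
      (∀ (b : Fin (6 + 6) → Bool) (a : Fin k → Fin (6 + 6) → Bool),
        M ∣ ∑ ε : Fin k → Bool, sZ (D (fun j => b j ^^ decide (Odd #(univ.filter fun i => ε i && a i j))))) →
      ∀ (b : Fin (6 + 6) → Bool) (a : Fin k → Fin (6 + 6) → Bool),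
        M ∣ ∑ ε : Fin k → Bool, (e (fun j => b j ^^ decide (Odd #(univ.filter fun i => ε i && a i j))) -
          sZ (D (fun j => b j ^^ decide (Odd #(univ.filter fun i => ε i && a i j))))) := by
    intro k M he hD' b a
    rw [sum_sub_distrib]
    exact dvd_sub (he b a) (hD' b a)
  have hcomb5 := hcomb 5 8 hflat5 hquad5
  -- on `P`: `4 ∣ e − σ`
  have hdig4 : ∀ x, x ∈ P → (4 : ℤ) ∣ e x - sZ (D x) := fun x hx => hDig x ((hmemP x).1 hx)
  -- ONE ROUND of wild-point parity on `P`: if `q ∣ e − σ` on `P`, the flat layer gives `2q ∣` on flats, and odd quotients are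
  -- too expensive, then `2q ∣ e − σ` on `P`
  have hround : ∀ (q : ℤ) (r : ℕ) (c : ℤ), 0 < q →
      (∀ x, x ∈ P → q ∣ e x - sZ (D x)) →
      (∀ (b : Fin (6 + 6) → Bool) (a : Fin (r + 1) → Fin (6 + 6) → Bool),
        2 * q ∣ ∑ ε : Fin (r + 1) → Bool, (e (fun j => b j ^^ decide (Odd #(univ.filter fun i => ε i && a i j))) -
          sZ (D (fun j => b j ^^ decide (Odd #(univ.filter fun i => ε i && a i j)))))) →
      (∀ x, x ∈ P → Odd ((e x - sZ (D x)) / q) → c ≤ e x ^ 2 - 1) →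
      960 < c * 2 ^ (11 - r) → 0 ≤ c → r ≤ 11 →
      ∀ x, x ∈ P → 2 * q ∣ e x - sZ (D x) := by
    intro q r c hq hdiv hlayer hc hbudget hc0 hr
    have hq' : ∀ y, y ∈ P → e y - sZ (D y) = q * ((e y - sZ (D y)) / q) := fun y hy => (Int.mul_ediv_cancel' (hdiv y hy)).symm
    rcases ws_erm_round V hV0 hVadd hVcard x₀ (fun y => (e y - sZ (D y)) / q) r (fun b hb a ha => by
        have hbP : b ∈ P := by rw [hPimg]; exact hb
        have hpts : ∀ ε : Fin (r + 1) → Bool, (fun j => b j ^^ decide (Odd #(univ.filter fun i => ε i && a i j))) ∈ P :=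
          fun ε => ws_flatPt_mem V hV0 (· ∈ P) hPV (r + 1) b hbP a ha ε
        have h := hlayer b a
        rw [sum_congr rfl fun ε _ => hq' _ (hpts ε), ← mul_sum] at h
        exact (mul_dvd_mul_iff_left hq.ne').1 (by rw [mul_comm q 2]; exact h)) with hev | hbig
    · intro x hx
      obtain ⟨k, hk⟩ := hev x (by rw [← hPimg]; exact hx)
      exact ⟨k, by rw [hq' x hx, hk]; ring⟩
    · exfalso
      rw [← hPimg] at hbig
      have hT := hcost (P.filter fun x => Odd ((e x - sZ (D x)) / q)) c (filter_subset _ _) (fun x hx => by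
          have hx' := mem_filter.1 hx
          exact hc x hx'.1 hx'.2)
      -- `2^11 ≤ 2^r · #T` and `c · #T ≤ 960 < c · 2^{11−r}`
      have hTcard : 2 ^ (11 - r) ≤ #(P.filter fun x => Odd ((e x - sZ (D x)) / q)) := by
        have e11 : 2 ^ 11 = 2 ^ r * 2 ^ (11 - r) := by rw [← pow_add]; congr 1; omega
        rw [e11] at hbig
        exact Nat.le_of_mul_le_mul_left hbig (by positivity)
      have : c * 2 ^ (11 - r) ≤ c * #(P.filter fun x => Odd ((e x - sZ (D x)) / q)) := by
        have h' : ((2 : ℤ) ^ (11 - r) : ℤ) ≤ (#(P.filter fun x => Odd ((e x - sZ (D x)) / q)) : ℤ) := by exact_mod_cast hTcard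
        exact mul_le_mul_of_nonneg_left h' hc0
      linarith
  -- a point with `q ∣ e − σ`, odd quotient, has `|e| ≥ q − 1`
  have hptcost : ∀ (q c : ℤ), 2 ≤ q → (q - 1) ^ 2 - 1 = c → ∀ x, x ∈ P → q ∣ e x - sZ (D x) → Odd ((e x - sZ (D x)) / q) →
      c ≤ e x ^ 2 - 1 := by
    intro q c hq hc x hx hdiv hoddq
    have hq' : e x - sZ (D x) = q * ((e x - sZ (D x)) / q) := (Int.mul_ediv_cancel' hdiv).symm
    set t := (e x - sZ (D x)) / q with ht
    have ht1 : t ≤ -1 ∨ 1 ≤ t := by have := Int.odd_iff.1 hoddq; omega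
    have hs := tp_sZ_cases (D x)
    have key : e x ≤ -(q - 1) ∨ q - 1 ≤ e x := by
      rcases ht1 with ht1 | ht1
      · left
        have : q * t ≤ q * (-1) := mul_le_mul_of_nonneg_left ht1 (by linarith)
        rcases hs with hs | hs <;> rw [hs] at hq' <;> linarith
      · right
        have : q * 1 ≤ q * t := mul_le_mul_of_nonneg_left ht1 (by linarith)
        rcases hs with hs | hs <;> rw [hs] at hq' <;> linarith
    have := tp_sq_ge (k := q - 1) (by linarith) key
    linarith
  -- rounds: `8 ∣`, `16 ∣`, `32 ∣ e − σ` on `P`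
  have hr1 : ∀ x, x ∈ P → (8 : ℤ) ∣ e x - sZ (D x) := by
    have h := hround 4 4 8 (by norm_num) hdig4 (fun b a => hcomb5 b a) (fun x hx hq => hptcost 4 8 (by norm_num) (by norm_num) x hx
      (hdig4 x hx) hq) (by norm_num) (by norm_num) (by norm_num)
    intro x hx; have := h x hx; norm_num at this; exact this

  /- NEW (gen 20): the function `r = (e − σ)/8` on `P` -/
  set r : (Fin (6 + 6) → Bool) → ℤ := fun x => if x ∈ P then (e x - sZ (D x)) / 8 else 0 with hrdef
  have hrP : ∀ x, x ∈ P → e x = sZ (D x) + 8 * r x := by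
    intro x hx
    simp only [r, if_pos hx]
    have := Int.mul_ediv_cancel' (hr1 x hx)
    linarith
  have hroff : ∀ x, x ∉ P → r x = 0 := fun x hx => by simp only [r, if_neg hx]
  -- cost: `e² − 1 = 16 r (4r + σ) ≥ 48 r²` on `P`
  have hcost48 : ∀ x, x ∈ P → 48 * r x ^ 2 ≤ e x ^ 2 - 1 := by
    intro x hx
    rw [hrP x hx]
    have habs : |r x| ≤ r x ^ 2 := by
      rcases le_or_gt 0 (r x) with h | h
      · rw [abs_of_nonneg h]; nlinarith
      · rw [abs_of_neg h]; nlinarith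
    rcases tp_sZ_cases (D x) with hs | hs <;> rw [hs]
    · nlinarith [abs_le.1 habs |>.1, abs_le.1 habs |>.2, le_abs_self (r x), neg_abs_le (r x)]
    · nlinarith [abs_le.1 habs |>.1, abs_le.1 habs |>.2, le_abs_self (r x), neg_abs_le (r x)]
  have hsumP : ∑ x ∈ P, (e x ^ 2 - 1) ≤ 960 := by
    have h3 : ∑ x ∈ P, (e x ^ 2 - 1) = ∑ x ∈ P, e x ^ 2 - 2048 := by
      rw [sum_sub_distrib, sum_const, hcardP]; norm_num
    linarith
  have hr20 : ∑ x, r x ^ 2 ≤ 20 := by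
    have hsplitr : ∑ x, r x ^ 2 = ∑ x ∈ P, r x ^ 2 := by
      refine (sum_subset (subset_univ P) fun x _ hx => ?_).symm
      rw [hroff x hx]; ring
    have h1 : 48 * ∑ x ∈ P, r x ^ 2 ≤ ∑ x ∈ P, (e x ^ 2 - 1) := by
      rw [mul_sum]; exact sum_le_sum fun x hx => hcost48 x hx
    rw [hsplitr]; linarith
  -- `r̂`
  have hrabs : ∀ y, |∑ x, (r x : ℝ) * twist x y| ≤ 20 := by
    intro y
    calc |∑ x, (r x : ℝ) * twist x y| ≤ ∑ x, |(r x : ℝ) * twist x y| := abs_sum_le_sum_abs _ _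
      _ = ∑ x, |(r x : ℝ)| := sum_congr rfl fun x _ => by
          rw [abs_mul]; rcases twist_eq_one_or x y with h | h <;> rw [h] <;> simp
      _ ≤ ∑ x, ((r x : ℝ)) ^ 2 := sum_le_sum fun x _ => by
          rw [← Int.cast_abs]
          have habs : |r x| ≤ r x ^ 2 := by
            rcases le_or_gt 0 (r x) with h | h
            · rw [abs_of_nonneg h]; nlinarith
            · rw [abs_of_neg h]; nlinarith
          exact_mod_cast habs
      _ ≤ 20 := by
          have : ((∑ x, r x ^ 2 : ℤ) : ℝ) ≤ 20 := by exact_mod_cast hr20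
          push_cast at this; exact this
  have hrpars : ∑ y, (∑ x, (r x : ℝ) * twist x y) ^ 2 ≤ 81920 := by
    have h := sum_W_sq (n := 6 + 6) (fun x => (r x : ℝ))
    unfold W at h
    rw [h]
    have : ((∑ x, r x ^ 2 : ℤ) : ℝ) ≤ 20 := by exact_mod_cast hr20
    push_cast at this
    norm_num
    linarith
  /- NEW (gen 20): straddling 5-flats ⇒ all 4-flat sums of `σ` inside `P` are `≡ 0 (mod 8)` -/
  obtain ⟨v₀, hv₀⟩ := es_exists_twist_neg hγ0
  have hv₀V : v₀ ∉ V := by rw [hVmem, hv₀]; norm_num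
  have H8 : ∀ x : Fin (6 + 6) → Bool, twist γ x = tg → ∀ a b c d : Fin (6 + 6) → Bool, twist γ a = 1 → twist γ b = 1 → twist γ c = 1 →
      twist γ d = 1 → (8 : ℤ) ∣ ∑ ε : Fin 4 → Bool, sZ (D (fun j => x j ^^ decide (Odd #(univ.filter fun i =>
        ε i && (![a, b, c, d] : Fin 4 → Fin (6 + 6) → Bool) i j)))) := by
    intro x hx a b c d ha hb hc hd
    have hxP : x ∈ P := (hmemP' x).2 hx
    have hdir : ∀ i, (![a, b, c, d] : Fin 4 → Fin (6 + 6) → Bool) i ∈ V := by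
      intro i; fin_cases i
      · exact (hVmem a).2 ha
      · exact (hVmem b).2 hb
      · exact (hVmem c).2 hc
      · exact (hVmem d).2 hd
    have hpts : ∀ ε : Fin 4 → Bool, (fun j => x j ^^ decide (Odd #(univ.filter fun i =>
        ε i && (![a, b, c, d] : Fin 4 → Fin (6 + 6) → Bool) i j))) ∈ P :=
      fun ε => ws_flatPt_mem V hV0 (· ∈ P) hPV 4 x hxP _ hdir ε
    have h5 := hflat5 x (Matrix.vecCons v₀ ![a, b, c, d])
    rw [fr_sum_peel e x v₀ ![a, b, c, d]] at h5
    -- the translated half lies off `P`, where `e = 0`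
    have hoffP : ∀ ε : Fin 4 → Bool, bxor (fun j => x j ^^ decide (Odd #(univ.filter fun i =>
        ε i && (![a, b, c, d] : Fin 4 → Fin (6 + 6) → Bool) i j))) v₀ ∉ P := by
      intro ε hmem
      have h1 := (hmemP' _).1 (hpts ε)
      have h2 := (hmemP' _).1 hmem
      rw [twist_bxor_right, h1, hv₀] at h2
      rcases htg with h | h <;> rw [h] at h2 <;> norm_num at h2
    rw [sum_eq_zero (fun ε _ => he0 _ (fun h => hoffP ε ((hmemP _).2 h))), add_zero,
      sum_congr rfl fun ε _ => hrP _ (hpts ε), sum_add_distrib, ← mul_sum] at h5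
    exact (dvd_add_left (dvd_mul_right 8 _)).1 h5
  /- the hyperplane character sums -/
  obtain ⟨m, hm, hpar⟩ := qs_hyperplane_sum_parity D hD γ tg htg
  have hgran : ∀ y, m y = 0 ∨ |m y| = 16 ∨ |m y| = 32 := gr20_hyperplane_granular_m16 D hD γ hγ0 tg htg H8 m hm
  -- `m ≢ 0` (Parseval for `σ·1_P`)
  have hmne : ∃ y, m y ≠ 0 := by
    by_contra hall
    push Not at hall
    set F : (Fin (6 + 6) → Bool) → ℝ := fun x => if twist γ x = tg then signOf (D x) else 0 with hF
    have hWF : ∀ y, W F y = 64 * (m y : ℝ) := by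
      intro y
      rw [← hm y]
      unfold W
      rw [sum_filter]
      refine sum_congr rfl fun x _ => ?_
      simp only [F]
      split_ifs with h
      · rw [tp_sZ_cast]
      · rw [zero_mul]
    have hpars := sum_W_sq (n := 6 + 6) F
    simp only [hWF, hall, Int.cast_zero, mul_zero] at hpars
    have hF2 : ∑ y, F y ^ 2 = 2048 := by
      have : ∀ y, F y ^ 2 = if twist γ y = tg then (1 : ℝ) else 0 := by
        intro y; simp only [F]; split_ifs with h
        · cases D y <;> simp [signOf]
        · simp
      rw [sum_congr rfl fun y _ => this y, sum_boole, tw59_card_half γ hγ0 tg htg]; norm_num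
    rw [hF2] at hpars
    norm_num at hpars
  /- Walsh inversion: the partner's spectrum -/
  have hinv : ∀ y, ∑ x, (u' x : ℝ) * twist x y = 128 * signOf (g y) := by
    intro y
    have h := tz_inversion (fun y => signOf (g y)) y
    rw [sum_congr rfl fun x _ => by rw [hu' x]] at h
    have h' : (2 : ℝ) ^ 5 * ∑ x, (u' x : ℝ) * twist x y = 2 ^ (6 + 6) * signOf (g y) := by
      rw [mul_sum, ← h]; exact sum_congr rfl fun x _ => by ring
    have e128 : (2 : ℝ) ^ (6 + 6) = 2 ^ 5 * 128 := by norm_num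
    rw [e128, mul_assoc] at h'
    exact mul_left_cancel₀ (by positivity) h'
  have hu'form : ∀ x, u' x = 2 * sZ (f x) + (if Odd (u' x) then sZ (D x) + 8 * r x else 0) := by
    intro x
    by_cases hx : Odd (u' x)
    · rw [if_pos hx]
      have := hrP x ((hmemP x).2 hx)
      simp only [e] at this
      linarith
    · rw [if_neg hx, add_zero]; exact hoff x hx
  have hWf : ∀ y, W (fun x => signOf (f x)) y = 64 * signOf (g y) - 32 * (m y : ℝ) - 4 * ∑ x, (r x : ℝ) * twist x y := by
    intro y
    have h := hinv y
    have hpt : ∀ x, (u' x : ℝ) * twist x y = 2 * (signOf (f x) * twist x y) +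
        (if twist γ x = tg then (sZ (D x) : ℝ) * twist x y else 0) + 8 * ((r x : ℝ) * twist x y) := by
      intro x
      by_cases hx : twist γ x = tg
      · have hxo : Odd (u' x) := (hPg x).2 hx
        rw [if_pos hx, hu'form x, if_pos hxo]; push_cast; rw [tp_sZ_cast]; ring
      · have hxo : ¬ Odd (u' x) := fun h => hx ((hPg x).1 h)
        rw [if_neg hx, hu'form x, if_neg hxo, hroff x (fun hP => hxo ((hmemP x).1 hP))]; push_cast; rw [tp_sZ_cast]; ring
    have hsplit3 : ∑ x, (u' x : ℝ) * twist x y = 2 * ∑ x, signOf (f x) * twist x y +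
        ∑ x ∈ univ.filter (fun x : Fin (6 + 6) → Bool => twist γ x = tg), (sZ (D x) : ℝ) * twist x y +
        8 * ∑ x, (r x : ℝ) * twist x y := by
      rw [sum_congr rfl fun x _ => hpt x, sum_add_distrib, sum_add_distrib, ← mul_sum, ← mul_sum, sum_filter]
    rw [hsplit3, hm y] at h
    unfold W
    linarith
  -- `Φ < 1`: the residual is odd somewhere
  have hΦlt : forrelation f g < 1 := by
    obtain ⟨x₁, hx₁⟩ := hodd
    have h1 : 1 ≤ e x₁ ^ 2 := hsq1 x₁ ((hmemP x₁).2 hx₁)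
    have h2 : e x₁ ^ 2 ≤ ∑ x, e x ^ 2 := single_le_sum (f := fun x => e x ^ 2) (fun x _ => sq_nonneg _) (mem_univ x₁)
    have h3 : (1 : ℝ) ≤ ((∑ x, e x ^ 2 : ℤ) : ℝ) := by exact_mod_cast h1.trans h2
    rw [hBR] at h3
    linarith
  exact ⟨γ, tg, D, r, m, htg, hγ0, hPg, hD, fun x hx => hroff x (fun hP => hx ((hmemP x).1 hP)), hu'form, hr20, hrabs, hrpars,
    hgran, hmne, hm, hWf, hΦlt⟩

end Summit.QuantumAdvantage.QuantumAdvantage.Theorems.CubicForrelation.NearExactIsExact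

end
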